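import Mathlib
import Literature.Probability.Percolation.SmoothedWhiteNoise
import Literature.Probability.Percolation.ZdNearCriticalWindow

/-!
# Measurability of the sign configuration of the smoothed lattice white noise

Helper file for item `NoiseDiscretisation` (stmt-CriticalPhenomena-4598) of route
`CardyWhiteToColoured` (`CardyFormulaZ2`). The lattice model of the route smooths i.i.d.
Gaussians `ξ_{e'}` on the edges of `ℤ²` by the Gaussian kernel at scale `ℓ`
(`smoothedNoise ℓ δ ξ x = ∑' e', exp(−|x − m_δ(e')|²/(2ℓ²)) ξ_{e'}`, an unconditional sum) and
opens the edges where the field is positive (`signConfig`). We prove that the field at a point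
is a measurable function of `ξ` (Mathlib's `Measurable.tsum` for real-valued countable sums),
that `signConfig ℓ δ` is a measurable map into bond configurations, and hence that the pull-back
of Smirnov's crossing event `discreteCrossing Ω δ A B` (measurable,
`measurableSet_discreteCrossing`) is a measurable set of noises — so that the crossing
probability `smoothedCrossingProb` is the law of `signConfig` evaluated on the event.

References: S. Muirhead, H. Vanneuville, Ann. Inst. H. Poincaré Probab. Stat. 56 (2020), §2.1
(discretised white noise); S. Smirnov, C. R. Acad. Sci. Paris 333 (2001), §2.
-/

noncomputable section

namespace Summit.CriticalPhenomena.CardyFormulaZ2.Theorems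

namespace WhiteToColoured

open Set MeasureTheory
open Literature.Probability.LatticeModels Literature.Probability.Percolation

/-- The smoothed lattice white noise at a point is a measurable function of the noise
(a countable unconditional sum of measurable functions, `Measurable.tsum`). -/
theorem measurable_smoothedNoise (ℓ δ : ℝ) (x : ℂ) :
    Measurable fun ξ : (zdGraph 2).edgeSet → ℝ => smoothedNoise ℓ δ ξ x := by
  unfold smoothedNoise
  refine Measurable.tsum fun e' => ?_
  exact measurable_const.mul (measurable_pi_apply e')

/-- The sign configuration `ξ ↦ {e ∈ E(ℤ²) | F_{ℓ,δ}(ξ)(m_δ e) > 0}` is a measurable map into bond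
configurations of `ℤ²`. -/
theorem measurable_signConfig (ℓ δ : ℝ) : Measurable (signConfig ℓ δ) := by
  refine measurable_set_iff.2 fun e => ?_
  simp only [mem_signConfig_iff]
  refine measurable_to_prop ?_
  have : (fun ξ : (zdGraph 2).edgeSet → ℝ => e ∈ (zdGraph 2).edgeSet ∧
      0 < smoothedNoise ℓ δ ξ (medialPoint δ e)) ⁻¹' {True} =
      {ξ | e ∈ (zdGraph 2).edgeSet ∧ 0 < smoothedNoise ℓ δ ξ (medialPoint δ e)} := by
    ext ξ; simp
  rw [this]
  exact (measurableSet_setOf.2 measurable_const).inter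
    (measurableSet_lt measurable_const (measurable_smoothedNoise ℓ δ _))

/-- The pull-back of Smirnov's crossing event by the sign configuration is a measurable set of
noises. -/
theorem measurableSet_signConfig_preimage_discreteCrossing (ℓ δ : ℝ) (Ω A B : Set ℂ) :
    MeasurableSet (signConfig ℓ δ ⁻¹' discreteCrossing Ω δ A B) :=
  (measurableSet_discreteCrossing Ω δ A B).preimage (measurable_signConfig ℓ δ)

/-- The crossing probability of the smoothed lattice model is the law of the sign configuration
evaluated on the crossing event. -/
theorem smoothedCrossingProb_eq_signConfigLaw (ℓ δ : ℝ) (Ω A B : Set ℂ) :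
    smoothedCrossingProb ℓ δ Ω A B = (signConfigLaw ℓ δ).real (discreteCrossing Ω δ A B) :=
  smoothedCrossingProb_eq_signConfigLaw_real (measurable_signConfig ℓ δ)
    (measurableSet_discreteCrossing Ω δ A B)

end WhiteToColoured

end Summit.CriticalPhenomena.CardyFormulaZ2.Theorems
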